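import Literature.NumberTheory.LFunctions.Zhang2022.Section10Lemma102SSteps
import Literature.NumberTheory.LFunctions.Zhang2022.RepairGapLemma102LogMeanPremise
import HarnessLib

/-!
# Zhang (2022), rescue GAP/BED (D-0124 (3)(4)): §10 Remark p. 57 — the SHIFTED relative clauses (10.8)ˢ/(10.9)ˢ/(10.10)ˢ of
# Lemma 10.2 (`frakv2S`, `y* = drP^{0.004}/(Dt₀)`) under the minimum premise `‖L(1,χ)‖ ≤ 𝓛⁻¹⁵`, UNCONDITIONAL

Topic `Literature/NumberTheory/LFunctions/Zhang2022` (Landau–Siegel audit tree; verdict-neutral).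
Y. Zhang, *Discrete mean estimates and the Landau–Siegel zero*, arXiv:2211.02515v1 (2022)
[Zhang2022LandauSiegel] — **an unrefereed manuscript under adjudication; nothing in this file asserts or
denies its Theorems 1–2, and nothing here is a claim about Landau–Siegel zeros. The programme SEARCHES and
TYPES; no claim about Landau–Siegel zeros, Theorems 1–2 of arXiv:2211.02515 or a repaired Margin232 until a
kernel theorem says so.**

The tree edges `Lemma102.eq108SRel_of_logMean` / `eq109SRel_of_logMean` / `eq1010SRel_of_logMean` (`Section10Lemma102SSteps`,
zl-w10-p6) derive the three shifted relative clauses of Lemma 10.2 (Remark p. 57: the argument of Lemma 10.2 applied to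
`𝔳₂ⱼ` with `y` replaced by `y* = drP^{0.004}/(Dt₀)`) from the shift-0 log-mean estimate LEMMA A (`Typed.Sec10Rel.LogMean0Rel`)
through the guard-free pointwise engines `frakv2S_low/mid/top_of_key`; Assumption (A) is only THREADED into LEMMA A, which is a
kernel theorem at (A)-exponent 15 (`Lemma102.logMean0Rel_pow15`, `RepairGapLemma102LogMeanPremise`, bed-2 g6). This file re-runs the
three edges VERBATIM with the guard text `AssumptionA D χ →` replaced by `‖L(1,χ)‖ ≤ 𝓛⁻¹⁵ →` (`eq108SRel_pow15_of_logMean`,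
`eq109SRel_pow15_of_logMean`, `eq1010SRel_pow15_of_logMean`; the unshifted twins are g6's `RepairGapLemma102StepsPremise`) and applies
them to `logMean0Rel_pow15`: **`eq108SRel_pow15`, `eq109SRel_pow15`, `eq1010SRel_pow15` — the shifted (10.8)/(10.9)/(10.10), relative
form, at guard `𝓛⁻¹⁵`, every real `c′`, UNCONDITIONAL.** Inputs of the §10c range evaluations of `S_j(𝐚₁₂,𝐚₁₄)`
(`low1214Eval`, `mid1214Eval`, `top1214Eval`; whole-DAG binder `hG1214`) at E = 15. Theorems only; no definition, no named fact;
nothing about (A) itself. The private helpers of the source section are copied (suffix `_ss15`).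

## References

* Y. Zhang, arXiv:2211.02515v1 (2022), §10 (10.8)–(10.10) p. 54 and Remark p. 57. [cite: Zhang2022LandauSiegel, §10 Remark p.57]
-/

noncomputable section

open Complex Real

namespace Literature.NumberTheory.LFunctions.Zhang2022.Lemma102

open Literature.NumberTheory.LFunctions.Zhang2022.Skeleton
open Literature.NumberTheory.LFunctions.Zhang2022.Typed.Sec10B

variable {c' : ℝ}

/-! ### Size facts for the shift `y ↦ y* = yP^{0.004}/(Dt₀)` -/

/-- `𝓛 ≥ 5 ⇒ D ≥ 2`. [folklore] -/
private theorem two_le_of_five_le_ell_ss15 {D : ℕ} (hℓ : 5 ≤ ell D) : 2 ≤ D := by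
  by_contra h
  have h2 : D < 2 := not_le.mp h
  interval_cases D
  · simp [ell] at hℓ; linarith
  · simp [ell] at hℓ; linarith


/-- Threshold: `D ≥ ⌈e⁵⌉ ⇒ 𝓛 ≥ 5`. [folklore] -/
private theorem five_le_ell_ss15 {D : ℕ} (hD : ⌈Real.exp 5⌉₊ ≤ D) : 5 ≤ ell D := by
  have h1 : Real.exp 5 ≤ (D : ℝ) := le_trans (Nat.le_ceil _) (by exact_mod_cast hD)
  have h2 := Real.log_le_log (Real.exp_pos _) h1
  rwa [Real.log_exp] at h2

/-- The common largeness facts at `𝓛 ≥ 5`: `D ≥ 2`, `2 ≤ log D`, `P > 1`, and for `d, r ≥ 1`: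
`1 ≤ dr ≤ y*`, and `y* ≤ P^{0.504}/T ⇒ dr < PT⁻²`. [cite: Zhang2022LandauSiegel, §10 Remark p. 57] -/
private theorem large_facts_ss15 {D d r : ℕ} (hℓ : 5 ≤ ell D) (hd : 1 ≤ d) (hr : 1 ≤ r) :
    2 ≤ D ∧ 2 ≤ Real.log D ∧ 1 < bigP D ∧ 1 ≤ yShift D ((d * r : ℕ) : ℝ) ∧
      (yShift D ((d * r : ℕ) : ℝ) ≤ bigP D ^ (0.504 : ℝ) / bigT D →
        ((d * r : ℕ) : ℝ) < bigP D / bigT D ^ 2) := by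
  have hD2 := two_le_of_five_le_ell_ss15 hℓ
  have hlog : 2 ≤ Real.log D := by
    have h2 : (2 : ℝ) ≤ ell D := by linarith
    rw [ell] at h2
    exact h2
  have hℓ0 : 0 < ell D := by linarith
  have hP1 : 1 < bigP D := by rw [bigP]; exact Real.one_lt_exp_iff.mpr (pow_pos hℓ0 9)
  have hy1 : (1 : ℝ) ≤ ((d * r : ℕ) : ℝ) := by
    have : 1 ≤ d * r := Nat.one_le_iff_ne_zero.mpr (Nat.mul_ne_zero (by omega) (by omega))
    exact_mod_cast this
  have hys : ((d * r : ℕ) : ℝ) ≤ yShift D ((d * r : ℕ) : ℝ) := le_yShift hℓ (by linarith)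
  refine ⟨hD2, hlog, hP1, hy1.trans hys, fun h => ?_⟩
  have hT1 : 1 ≤ bigT D := Real.one_le_exp (by positivity)
  have h2 : bigP D ^ (0.504 : ℝ) / bigT D ≤ bigP D ^ (0.504 : ℝ) :=
    div_le_self (by positivity) hT1
  have h3 : bigP D ^ (0.504 : ℝ) < bigP D / bigT D ^ 2 := P1_lt_P_div_T_sq D hlog
  linarith

/-- Tolerance bookkeeping: `k·(Cℓ⁻⁶R)/ℓ⁹ ≤ k·max C 0·ℓ⁻¹⁵·R`. [folklore] -/
private theorem tol_le_ss15 {k C ℓ R : ℝ} (hk : 0 ≤ k) (hℓ : 0 < ℓ) (hR : 0 ≤ R) :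
    k * (C * (ℓ ^ 6)⁻¹ * R) / ℓ ^ 9 ≤ k * max C 0 * (ℓ ^ 15)⁻¹ * R := by
  have hC : C ≤ max C 0 := le_max_left _ _
  have e : k * (C * (ℓ ^ 6)⁻¹ * R) / ℓ ^ 9 = k * C * (ℓ ^ 15)⁻¹ * R := by
    field_simp
  rw [e]
  have : 0 ≤ k * (ℓ ^ 15)⁻¹ * R := by positivity
  nlinarith
/-- **Shifted (10.8), relative form, at (A)-exponent 15, from the shift-0 log-mean estimate at 15** (tree edge
`eq108SRel_of_logMean` verbatim, guard `AssumptionA D χ` ↦ `‖L(1,χ)‖ ≤ 𝓛⁻¹⁵`): if `y* ≤ P^{0.5}/T` then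
`‖frakv2S − (L′(1,χ)Π(d,r)/500)β_{j+1}β_{j+2}log P‖ ≤ 2000·max C 0·𝓛⁻¹⁵(∏_{q∣dr}(1−q⁻¹)⁻¹)²`.
[cite: Zhang2022LandauSiegel, §10 (10.8), Remark p. 57] -/
theorem eq108SRel_pow15_of_logMean (hA : ∃ C : ℝ, ForAllLarge fun D _ χ => ‖χ.LFunction 1‖ ≤ 1 / Real.log D ^ 15 → ∀ j ∈ ({1, 2, 3} : Finset ℕ), ∀ d r : ℕ,
      1 ≤ d → 1 ≤ r → ((d * r : ℕ) : ℝ) < bigP D / bigT D ^ 2 → ∀ x : ℝ, bigT D ≤ x → x ≤ bigP D →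
        ‖(∑ n ∈ Finset.Ioc 0 ⌊x⌋₊, χ (n : ZMod D) * xiZero c' D j n d r / (n : ℂ) *
              (Real.log (x / n) : ℂ)) -
            deriv χ.LFunction 1 * PiW χ d r *
              (1 + (betaJ c' D (j + 1) + betaJ c' D (j + 2)) * (Real.log x : ℂ) +
                betaJ c' D (j + 1) * betaJ c' D (j + 2) * (Real.log x : ℂ) ^ 2 / 2)‖ ≤
          C * (ell D ^ 6)⁻¹ * (∏ q ∈ (d * r).primeFactors, (1 - (q : ℝ)⁻¹)⁻¹) ^ 2) :
    ∃ C : ℝ, ForAllLarge fun D _ χ => ‖χ.LFunction 1‖ ≤ 1 / Real.log D ^ 15 →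
      ∀ j ∈ ({1, 2, 3} : Finset ℕ), ∀ d r : ℕ, 1 ≤ d → 1 ≤ r →
        yShift D ((d * r : ℕ) : ℝ) ≤ bigP D ^ (0.5 : ℝ) / bigT D →
          ‖frakv2S c' χ j d r - deriv χ.LFunction 1 * PiW χ d r / 500 *
            (betaJ c' D (j + 1) * betaJ c' D (j + 2)) * Real.log (bigP D)‖ ≤
            C * (ell D ^ 15)⁻¹ * (∏ q ∈ (d * r).primeFactors, (1 - (q : ℝ)⁻¹)⁻¹) ^ 2 := by
  obtain ⟨C, D₀, h⟩ := hA
  refine ⟨2000 * max C 0, max D₀ ⌈Real.exp 5⌉₊, fun D _ χ hD hq hp hA' j hj d r hd hr hys => ?_⟩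
  have hD₀ : D₀ ≤ D := le_trans (le_max_left _ _) hD
  have hℓ : 5 ≤ ell D := five_le_ell_ss15 (le_trans (le_max_right _ _) hD)
  obtain ⟨hD2, -, hP1, hys1, hdrP⟩ := large_facts_ss15 hℓ hd hr
  have hys' : yShift D ((d * r : ℕ) : ℝ) ≤ bigP D ^ (0.504 : ℝ) / bigT D := by
    refine hys.trans (div_le_div_of_nonneg_right ?_ (Real.exp_pos _).le)
    exact Real.rpow_le_rpow_of_exponent_le hP1.le (by norm_num)
  have key := h D χ hD₀ hq hp hA' j hj d r hd hr (hdrP hys')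
  refine (frakv2S_low_of_key χ c' j hd hr hP1 hD2 key hys1 hys).trans ?_
  have hlogP : Real.log (bigP D) = ell D ^ 9 := by rw [bigP, Real.log_exp]
  rw [hlogP]
  exact tol_le_ss15 (by norm_num) (by linarith) (by positivity)
/-- **Shifted (10.9), relative form, at (A)-exponent 15, from the shift-0 log-mean estimate at 15** (tree edge
`eq109SRel_of_logMean` verbatim, guard swapped): if `P^{0.5} < y* ≤ P^{0.502}/T` then
`‖frakv2S − (500L′(1,χ)Π(d,r)/log P)(−1 + 𝔶₁ⱼ(y*))‖ ≤ 1500·max C 0·𝓛⁻¹⁵(∏_{q∣dr}(1−q⁻¹)⁻¹)²`.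
[cite: Zhang2022LandauSiegel, §10 (10.9), Remark p. 57] -/
theorem eq109SRel_pow15_of_logMean (hA : ∃ C : ℝ, ForAllLarge fun D _ χ => ‖χ.LFunction 1‖ ≤ 1 / Real.log D ^ 15 → ∀ j ∈ ({1, 2, 3} : Finset ℕ), ∀ d r : ℕ,
      1 ≤ d → 1 ≤ r → ((d * r : ℕ) : ℝ) < bigP D / bigT D ^ 2 → ∀ x : ℝ, bigT D ≤ x → x ≤ bigP D →
        ‖(∑ n ∈ Finset.Ioc 0 ⌊x⌋₊, χ (n : ZMod D) * xiZero c' D j n d r / (n : ℂ) *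
              (Real.log (x / n) : ℂ)) -
            deriv χ.LFunction 1 * PiW χ d r *
              (1 + (betaJ c' D (j + 1) + betaJ c' D (j + 2)) * (Real.log x : ℂ) +
                betaJ c' D (j + 1) * betaJ c' D (j + 2) * (Real.log x : ℂ) ^ 2 / 2)‖ ≤
          C * (ell D ^ 6)⁻¹ * (∏ q ∈ (d * r).primeFactors, (1 - (q : ℝ)⁻¹)⁻¹) ^ 2) :
    ∃ C : ℝ, ForAllLarge fun D _ χ => ‖χ.LFunction 1‖ ≤ 1 / Real.log D ^ 15 →
      ∀ j ∈ ({1, 2, 3} : Finset ℕ), ∀ d r : ℕ, 1 ≤ d → 1 ≤ r →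
        bigP D ^ (0.5 : ℝ) < yShift D ((d * r : ℕ) : ℝ) →
        yShift D ((d * r : ℕ) : ℝ) ≤ bigP D ^ (0.502 : ℝ) / bigT D →
          ‖frakv2S c' χ j d r - 500 * deriv χ.LFunction 1 * PiW χ d r / Real.log (bigP D) *
            (-1 + fraky1 c' D j (yShift D ((d * r : ℕ) : ℝ)))‖ ≤
            C * (ell D ^ 15)⁻¹ * (∏ q ∈ (d * r).primeFactors, (1 - (q : ℝ)⁻¹)⁻¹) ^ 2 := by
  obtain ⟨C, D₀, h⟩ := hA
  refine ⟨1500 * max C 0, max D₀ ⌈Real.exp 5⌉₊,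
    fun D _ χ hD hq hp hA' j hj d r hd hr hlo hys => ?_⟩
  have hD₀ : D₀ ≤ D := le_trans (le_max_left _ _) hD
  have hℓ : 5 ≤ ell D := five_le_ell_ss15 (le_trans (le_max_right _ _) hD)
  obtain ⟨hD2, -, hP1, -, hdrP⟩ := large_facts_ss15 hℓ hd hr
  have hys' : yShift D ((d * r : ℕ) : ℝ) ≤ bigP D ^ (0.504 : ℝ) / bigT D := by
    refine hys.trans (div_le_div_of_nonneg_right ?_ (Real.exp_pos _).le)
    exact Real.rpow_le_rpow_of_exponent_le hP1.le (by norm_num)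
  have key := h D χ hD₀ hq hp hA' j hj d r hd hr (hdrP hys')
  refine (frakv2S_mid_of_key χ c' j hd hr hP1 hD2 key hlo hys).trans ?_
  have hlogP : Real.log (bigP D) = ell D ^ 9 := by rw [bigP, Real.log_exp]
  rw [hlogP]
  exact tol_le_ss15 (by norm_num) (by linarith) (by positivity)
/-- **Shifted (10.10), relative form, at (A)-exponent 15, from the shift-0 log-mean estimate at 15** (tree edge
`eq1010SRel_of_logMean` verbatim, guard swapped): if `P^{0.502} < y* ≤ P^{0.504}/T` then
`‖frakv2S − (500L′(1,χ)Π(d,r)/log P)(1 + 𝔶₂ⱼ(y*))‖ ≤ 500·max C 0·𝓛⁻¹⁵(∏_{q∣dr}(1−q⁻¹)⁻¹)²`.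
[cite: Zhang2022LandauSiegel, §10 (10.10), Remark p. 57] -/
theorem eq1010SRel_pow15_of_logMean (hA : ∃ C : ℝ, ForAllLarge fun D _ χ => ‖χ.LFunction 1‖ ≤ 1 / Real.log D ^ 15 → ∀ j ∈ ({1, 2, 3} : Finset ℕ), ∀ d r : ℕ,
      1 ≤ d → 1 ≤ r → ((d * r : ℕ) : ℝ) < bigP D / bigT D ^ 2 → ∀ x : ℝ, bigT D ≤ x → x ≤ bigP D →
        ‖(∑ n ∈ Finset.Ioc 0 ⌊x⌋₊, χ (n : ZMod D) * xiZero c' D j n d r / (n : ℂ) *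
              (Real.log (x / n) : ℂ)) -
            deriv χ.LFunction 1 * PiW χ d r *
              (1 + (betaJ c' D (j + 1) + betaJ c' D (j + 2)) * (Real.log x : ℂ) +
                betaJ c' D (j + 1) * betaJ c' D (j + 2) * (Real.log x : ℂ) ^ 2 / 2)‖ ≤
          C * (ell D ^ 6)⁻¹ * (∏ q ∈ (d * r).primeFactors, (1 - (q : ℝ)⁻¹)⁻¹) ^ 2) :
    ∃ C : ℝ, ForAllLarge fun D _ χ => ‖χ.LFunction 1‖ ≤ 1 / Real.log D ^ 15 →
      ∀ j ∈ ({1, 2, 3} : Finset ℕ), ∀ d r : ℕ, 1 ≤ d → 1 ≤ r →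
        bigP D ^ (0.502 : ℝ) < yShift D ((d * r : ℕ) : ℝ) →
        yShift D ((d * r : ℕ) : ℝ) ≤ bigP D ^ (0.504 : ℝ) / bigT D →
          ‖frakv2S c' χ j d r - 500 * deriv χ.LFunction 1 * PiW χ d r / Real.log (bigP D) *
            (1 + fraky2 c' D j (yShift D ((d * r : ℕ) : ℝ)))‖ ≤
            C * (ell D ^ 15)⁻¹ * (∏ q ∈ (d * r).primeFactors, (1 - (q : ℝ)⁻¹)⁻¹) ^ 2 := by
  obtain ⟨C, D₀, h⟩ := hA
  refine ⟨500 * max C 0, max D₀ ⌈Real.exp 5⌉₊,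
    fun D _ χ hD hq hp hA' j hj d r hd hr hlo hys => ?_⟩
  have hD₀ : D₀ ≤ D := le_trans (le_max_left _ _) hD
  have hℓ : 5 ≤ ell D := five_le_ell_ss15 (le_trans (le_max_right _ _) hD)
  obtain ⟨hD2, -, hP1, -, hdrP⟩ := large_facts_ss15 hℓ hd hr
  have key := h D χ hD₀ hq hp hA' j hj d r hd hr (hdrP hys)
  refine (frakv2S_top_of_key χ c' j hd hr hP1 hD2 key hlo hys).trans ?_
  have hlogP : Real.log (bigP D) = ell D ^ 9 := by rw [bigP, Real.log_exp]
  rw [hlogP]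
  exact tol_le_ss15 (by norm_num) (by linarith) (by positivity)
/-- **Shifted (10.8), relative form, at (A)-exponent 15, UNCONDITIONAL, every real `c′`**: `eq108SRel_pow15_of_logMean` at LEMMA A
at 15 (`logMean0Rel_pow15`, bed-2 g6 p608820). [cite: Zhang2022LandauSiegel, §10 (10.8), Remark p. 57] -/
theorem eq108SRel_pow15 (c' : ℝ) :
    ∃ C : ℝ, ForAllLarge fun D _ χ => ‖χ.LFunction 1‖ ≤ 1 / Real.log D ^ 15 →
      ∀ j ∈ ({1, 2, 3} : Finset ℕ), ∀ d r : ℕ, 1 ≤ d → 1 ≤ r →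
        yShift D ((d * r : ℕ) : ℝ) ≤ bigP D ^ (0.5 : ℝ) / bigT D →
          ‖frakv2S c' χ j d r - deriv χ.LFunction 1 * PiW χ d r / 500 *
            (betaJ c' D (j + 1) * betaJ c' D (j + 2)) * Real.log (bigP D)‖ ≤
            C * (ell D ^ 15)⁻¹ * (∏ q ∈ (d * r).primeFactors, (1 - (q : ℝ)⁻¹)⁻¹) ^ 2 :=
  eq108SRel_pow15_of_logMean (logMean0Rel_pow15 c')

/-- **Shifted (10.9), relative form, at (A)-exponent 15, UNCONDITIONAL, every real `c′`**: `eq109SRel_pow15_of_logMean` at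
`logMean0Rel_pow15`. [cite: Zhang2022LandauSiegel, §10 (10.9), Remark p. 57] -/
theorem eq109SRel_pow15 (c' : ℝ) :
    ∃ C : ℝ, ForAllLarge fun D _ χ => ‖χ.LFunction 1‖ ≤ 1 / Real.log D ^ 15 →
      ∀ j ∈ ({1, 2, 3} : Finset ℕ), ∀ d r : ℕ, 1 ≤ d → 1 ≤ r →
        bigP D ^ (0.5 : ℝ) < yShift D ((d * r : ℕ) : ℝ) →
        yShift D ((d * r : ℕ) : ℝ) ≤ bigP D ^ (0.502 : ℝ) / bigT D →
          ‖frakv2S c' χ j d r - 500 * deriv χ.LFunction 1 * PiW χ d r / Real.log (bigP D) *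
            (-1 + fraky1 c' D j (yShift D ((d * r : ℕ) : ℝ)))‖ ≤
            C * (ell D ^ 15)⁻¹ * (∏ q ∈ (d * r).primeFactors, (1 - (q : ℝ)⁻¹)⁻¹) ^ 2 :=
  eq109SRel_pow15_of_logMean (logMean0Rel_pow15 c')

/-- **Shifted (10.10), relative form, at (A)-exponent 15, UNCONDITIONAL, every real `c′`**: `eq1010SRel_pow15_of_logMean` at
`logMean0Rel_pow15`. [cite: Zhang2022LandauSiegel, §10 (10.10), Remark p. 57] -/
theorem eq1010SRel_pow15 (c' : ℝ) :
    ∃ C : ℝ, ForAllLarge fun D _ χ => ‖χ.LFunction 1‖ ≤ 1 / Real.log D ^ 15 →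
      ∀ j ∈ ({1, 2, 3} : Finset ℕ), ∀ d r : ℕ, 1 ≤ d → 1 ≤ r →
        bigP D ^ (0.502 : ℝ) < yShift D ((d * r : ℕ) : ℝ) →
        yShift D ((d * r : ℕ) : ℝ) ≤ bigP D ^ (0.504 : ℝ) / bigT D →
          ‖frakv2S c' χ j d r - 500 * deriv χ.LFunction 1 * PiW χ d r / Real.log (bigP D) *
            (1 + fraky2 c' D j (yShift D ((d * r : ℕ) : ℝ)))‖ ≤
            C * (ell D ^ 15)⁻¹ * (∏ q ∈ (d * r).primeFactors, (1 - (q : ℝ)⁻¹)⁻¹) ^ 2 :=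
  eq1010SRel_pow15_of_logMean (logMean0Rel_pow15 c')

end Literature.NumberTheory.LFunctions.Zhang2022.Lemma102

end
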